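import Summits.CriticalPhenomena.PercolationContinuityZ3.Theorems.SahiAEFourFunctions
import Literature.Probability.LatticeModels.FourFunctionsAE
import Literature.Probability.LatticeModels.LikelihoodRatioOrder

/-!
# Holley–Preston / Karlin–Rinott Thm. 2.2 and FKG under ALMOST-EVERYWHERE cross conditions

Support file of the Sahi cell (`prim-sahi`, typer seat, generation 19; `--supports stmt-CriticalPhenomena-4575`).
Theorems only (no definitions, no named facts, no sorries).

The almost-everywhere four functions theorem (`lintegral_four_functions_ae`, resting on the diagonal lemma
`ae_le_of_ae_pair_le`) upgrades the density half of the likelihood-ratio / Holley–Preston theory of the tree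
(`Literature/Probability/LatticeModels/LikelihoodRatioOrder.lean`, everywhere hypotheses) to hypotheses on ALMOST
EVERY PAIR — the form in which cross conditions are actually available for densities that are only defined almost
everywhere (Radon–Nikodym derivatives, weak limits, disintegrations):

* `mTP2Le_of_ae_density` — [KarlinRinott1980] (2.8) / [MullerStoyan2002] (3.11.2) / Holley's hypothesis (7): two
  measurable densities `f, g : ℝ^ι → [0,∞]` w.r.t. a product `π` of σ-finite measures with
  `f(x) g(y) ≤ f(x ∧ y) g(x ∨ y)` for `π ⊗ π`-ALMOST EVERY `(x, y)` give tp₂-ordered laws `π·f ≤_tp π·g`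
  (`mTP2Le`; with `f = g` this is `mIsSetTP2_withDensity_pi_of_ae`).  All density-free consequences of the tree then
  apply verbatim: Holley's inequality `mTP2Le.integral_le` (stochastic domination of bounded increasing functions),
  up-sets `mTP2Le.upperSet_le`, conditioning on sublattices / boxes `mTP2Le.restrict_sublattice`, `…restrict_Icc`,
  monotone images `mTP2Le.map_pi_monotone`, marginals `mTP2Le.map_restrict`.
* `lintegral_mul_le_of_ae_tp2Density`, `integral_le_of_ae_tp2Density` — [KarlinRinott1980] Thm. 2.2 ((2.9)–(2.10))
  with the cross condition a.e.: `(∫ φ f)(∫ g) ≤ (∫ f)(∫ φ g)` for increasing `φ ≥ 0`, and `∫ φ d(π·f) ≤ ∫ φ d(π·g)`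
  for bounded increasing `φ` when `∫ f = ∫ g ∈ (0, ∞)`.
* `lintegral_fkg_of_ae_mtp2`, `fkg_of_ae_mtp2` — [KarlinRinott1980] Thm. 2.3 (FKG / positive association; Sarkar,
  Fortuin–Kasteleyn–Ginibre, Preston) for a density that is MTP₂ on ALMOST EVERY PAIR: `[0,∞]`-valued form
  `(∫ φ f)(∫ ψ f) ≤ (∫ φ ψ f)(∫ f)` for measurable increasing `φ, ψ : ℝ^ι → [0,∞]`, and the printed form
  `(∫ φ f)(∫ ψ f) ≤ ∫ φ ψ f` for a probability density and bounded increasing real `φ, ψ` — an a.e.-pair MTP₂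
  random vector is associated.

ATTRIBUTION (doc-only v2, cell finding A33-1).  That the Holley / Preston / FKG inequalities hold on finite products
of totally ordered σ-finite measure spaces as soon as the cross condition holds for `μ²`-ALMOST EVERY pair is in print:
[BattyBollmann1980] Thm. 3.7 (strong 𝔐-expansiveness of finite products, i.e. (1.13) under `μ²`-a.e. (1.7)) with its
§1 listing (1.5) (FKG), (1.6) (Holley) and (1.8) (Preston) as special cases and Remark 3.1(d) for the restriction to
sets.  The theorems below are those results for densities on `ℝ^ι`, rendered in the tree's likelihood-ratio
vocabulary, and are now tagged accordingly (proof route: Karlin–Rinott's reduction through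
`lintegral_four_functions_ae`).

No sorries, no new axioms.
-/

noncomputable section

namespace Summit.CriticalPhenomena.PercolationContinuityZ3.Theorems.SahiAEFourFunctions

open MeasureTheory Set Filter
open Literature.Probability.LatticeModels Literature.Probability.LatticeModels.Affiliation
open scoped ENNReal SetFamily

variable {ι : Type*} [Fintype ι]

/-- **tp₂-ordered laws from an a.e. cross condition on the densities** ([KarlinRinott1980] (2.8),
[MullerStoyan2002] (3.11.2), Holley's (7), Preston): for measurable `f, g : ℝ^ι → [0,∞]` with
`f(x) g(y) ≤ f(x ∧ y) g(x ∨ y)` for `π ⊗ π`-ALMOST EVERY `(x,y)` (`π = ⊗ᵢ mᵢ`, σ-finite factors), `π·f ≤_tp π·g`: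
`(π·f)(A) (π·g)(B) ≤ (π·f)(A ∧ B) (π·g)(A ∨ B)` for all measurable `A, B`.  (`lintegral_four_functions_ae` with
`f·1_A, g·1_B, g·1_{T₃}, f·1_{T₄}`, measurable hulls `T₃ ⊇ A ∨ B`, `T₄ ⊇ A ∧ B` of full outer measure; Batty–Bollmann's
(3.3) / Remark 3.1(d) for the `μ`-compatible quadruple `(f, g, g, f)`.)
[cite: BattyBollmann1980, Thm. 3.7 with Remark 3.1(d)] -/
theorem mTP2Le_of_ae_density (m : ι → Measure ℝ) [∀ i, SigmaFinite (m i)] {f g : (ι → ℝ) → ℝ≥0∞}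
    (hf : Measurable f) (hg : Measurable g)
    (hfg : ∀ᵐ p ∂(Measure.pi m).prod (Measure.pi m), f p.1 * g p.2 ≤ f (p.1 ⊓ p.2) * g (p.1 ⊔ p.2)) :
    mTP2Le ((Measure.pi m).withDensity f) ((Measure.pi m).withDensity g) := by
  intro A B hA hB
  set P := Measure.pi m with hP
  set T₃ := toMeasurable (P.withDensity g) (A ⊻ B) with hT₃
  set T₄ := toMeasurable (P.withDensity f) (A ⊼ B) with hT₄
  have mT₃ : MeasurableSet T₃ := measurableSet_toMeasurable _ _
  have mT₄ : MeasurableSet T₄ := measurableSet_toMeasurable _ _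
  have AD := Literature.Probability.LatticeModels.lintegral_four_functions_ae m (A.indicator f) (B.indicator g) (T₃.indicator g) (T₄.indicator f)
    (hf.indicator hA) (hg.indicator hB) (hg.indicator mT₃) (hf.indicator mT₄) (by
      filter_upwards [hfg] with p hp
      by_cases hx : p.1 ∈ A
      · by_cases hy : p.2 ∈ B
        · have h3 : p.1 ⊔ p.2 ∈ T₃ := subset_toMeasurable _ _ (Set.sup_mem_sups hx hy)
          have h4 : p.1 ⊓ p.2 ∈ T₄ := subset_toMeasurable _ _ (Set.inf_mem_infs hx hy)
          rw [Set.indicator_of_mem hx, Set.indicator_of_mem hy, Set.indicator_of_mem h3,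
            Set.indicator_of_mem h4, mul_comm (g (p.1 ⊔ p.2))]
          exact hp
        · rw [Set.indicator_of_notMem hy, mul_zero]
          exact zero_le
      · rw [Set.indicator_of_notMem hx, zero_mul]
        exact zero_le)
  rw [lintegral_indicator hA, lintegral_indicator hB, lintegral_indicator mT₃, lintegral_indicator mT₄,
    ← withDensity_apply f hA, ← withDensity_apply g hB, ← withDensity_apply g mT₃,
    ← withDensity_apply f mT₄] at AD
  rw [hT₃, hT₄, measure_toMeasurable, measure_toMeasurable] at AD
  calc P.withDensity f A * P.withDensity g B ≤ P.withDensity g (A ⊻ B) * P.withDensity f (A ⊼ B) := AD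
    _ = P.withDensity f (A ⊼ B) * P.withDensity g (A ⊻ B) := mul_comm _ _

/-- **Karlin–Rinott Thm. 2.2 ((2.9)) under the a.e. cross condition**: for measurable `f, g : ℝ^ι → [0,∞]` with
`f(x) g(y) ≤ f(x ∧ y) g(x ∨ y)` for `π ⊗ π`-a.e. `(x,y)` and every measurable increasing `φ : ℝ^ι → [0,∞]`,
`(∫ φ f dπ)(∫ g dπ) ≤ (∫ f dπ)(∫ φ g dπ)` — Preston's inequality (1.8) of [BattyBollmann1980] under the `μ²`-a.e.
hypothesis (1.7), a special case of their (1.13). [cite: BattyBollmann1980, Thm. 3.7 ((1.8) under a.e. (1.7))] -/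
theorem lintegral_mul_le_of_ae_tp2Density (m : ι → Measure ℝ) [∀ i, SigmaFinite (m i)]
    {f g : (ι → ℝ) → ℝ≥0∞} (hf : Measurable f) (hg : Measurable g)
    (hfg : ∀ᵐ p ∂(Measure.pi m).prod (Measure.pi m), f p.1 * g p.2 ≤ f (p.1 ⊓ p.2) * g (p.1 ⊔ p.2))
    {φ : (ι → ℝ) → ℝ≥0∞} (hφm : Measurable φ) (hφ : Monotone φ) :
    (∫⁻ x, φ x * f x ∂Measure.pi m) * (∫⁻ x, g x ∂Measure.pi m) ≤
      (∫⁻ x, f x ∂Measure.pi m) * ∫⁻ x, φ x * g x ∂Measure.pi m := by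
  have AD := Literature.Probability.LatticeModels.lintegral_four_functions_ae m (fun x => φ x * f x) g (fun x => φ x * g x) f (hφm.mul hf) hg
    (hφm.mul hg) hf (by
      filter_upwards [hfg] with p hp
      calc φ p.1 * f p.1 * g p.2 = φ p.1 * (f p.1 * g p.2) := mul_assoc _ _ _
        _ ≤ φ (p.1 ⊔ p.2) * (f (p.1 ⊓ p.2) * g (p.1 ⊔ p.2)) := mul_le_mul' (hφ le_sup_left) hp
        _ = φ (p.1 ⊔ p.2) * g (p.1 ⊔ p.2) * f (p.1 ⊓ p.2) := by ring)
  calc (∫⁻ x, φ x * f x ∂Measure.pi m) * (∫⁻ x, g x ∂Measure.pi m)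
      ≤ (∫⁻ x, φ x * g x ∂Measure.pi m) * ∫⁻ x, f x ∂Measure.pi m := AD
    _ = (∫⁻ x, f x ∂Measure.pi m) * ∫⁻ x, φ x * g x ∂Measure.pi m := mul_comm _ _

/-- **Karlin–Rinott (2.10) / (1.19), Holley–Preston stochastic domination, under the a.e. cross condition**: if
moreover `∫ f dπ = ∫ g dπ ∈ (0,∞)`, then `∫ φ d(π·f) ≤ ∫ φ d(π·g)` for every bounded measurable increasing real `φ`.
[cite: BattyBollmann1980, Thm. 3.7 ((1.6)/(1.8) under a.e. (1.7))] -/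
theorem integral_le_of_ae_tp2Density (m : ι → Measure ℝ) [∀ i, SigmaFinite (m i)]
    {f g : (ι → ℝ) → ℝ≥0∞} (hf : Measurable f) (hg : Measurable g)
    (hfg : ∀ᵐ p ∂(Measure.pi m).prod (Measure.pi m), f p.1 * g p.2 ≤ f (p.1 ⊓ p.2) * g (p.1 ⊔ p.2))
    (hmass : ∫⁻ x, f x ∂Measure.pi m = ∫⁻ x, g x ∂Measure.pi m) (hpos : ∫⁻ x, g x ∂Measure.pi m ≠ 0)
    (hfin : ∫⁻ x, g x ∂Measure.pi m ≠ ∞) {φ : (ι → ℝ) → ℝ} (hφm : Measurable φ) (hφ : Monotone φ)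
    {C : ℝ} (hφC : ∀ x, |φ x| ≤ C) :
    ∫ x, φ x ∂(Measure.pi m).withDensity f ≤ ∫ x, φ x ∂(Measure.pi m).withDensity g := by
  have hgu : (Measure.pi m).withDensity g univ = ∫⁻ x, g x ∂Measure.pi m := by
    rw [withDensity_apply g MeasurableSet.univ, Measure.restrict_univ]
  have hfu : (Measure.pi m).withDensity f univ = ∫⁻ x, f x ∂Measure.pi m := by
    rw [withDensity_apply f MeasurableSet.univ, Measure.restrict_univ]
  haveI : IsFiniteMeasure ((Measure.pi m).withDensity g) := ⟨by rw [hgu]; exact hfin.lt_top⟩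
  haveI : IsFiniteMeasure ((Measure.pi m).withDensity f) := ⟨by rw [hfu, hmass]; exact hfin.lt_top⟩
  exact (mTP2Le_of_ae_density m hf hg hfg).integral_le (by rw [hfu, hgu, hmass]) (by rwa [hgu]) hφm hφ hφC

/-- **Karlin–Rinott Thm. 2.3 (FKG / positive association) for a density that is MTP₂ on ALMOST EVERY PAIR**,
`[0,∞]`-valued form: for measurable `f : ℝ^ι → [0,∞]` with `f(x) f(y) ≤ f(x ∧ y) f(x ∨ y)` for `π ⊗ π`-a.e.
`(x,y)` and measurable increasing `φ, ψ : ℝ^ι → [0,∞]`, `(∫ φ f dπ)(∫ ψ f dπ) ≤ (∫ φ ψ f dπ)(∫ f dπ)`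
(the printed reduction (2.13) to the four functions `φf, ψf, φψf, f`, now through `lintegral_four_functions_ae`);
the FKG inequality (1.5) of [BattyBollmann1980] under the `μ²`-a.e. lattice hypothesis.
[cite: BattyBollmann1980, Thm. 3.7 ((1.5) under a.e. (1.7))] -/
theorem lintegral_fkg_of_ae_mtp2 (m : ι → Measure ℝ) [∀ i, SigmaFinite (m i)] {f : (ι → ℝ) → ℝ≥0∞}
    (hf : Measurable f)
    (hMTP : ∀ᵐ p ∂(Measure.pi m).prod (Measure.pi m), f p.1 * f p.2 ≤ f (p.1 ⊓ p.2) * f (p.1 ⊔ p.2))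
    {φ ψ : (ι → ℝ) → ℝ≥0∞} (hφm : Measurable φ) (hψm : Measurable ψ) (hφ : Monotone φ) (hψ : Monotone ψ) :
    (∫⁻ x, φ x * f x ∂Measure.pi m) * (∫⁻ x, ψ x * f x ∂Measure.pi m) ≤
      (∫⁻ x, φ x * ψ x * f x ∂Measure.pi m) * ∫⁻ x, f x ∂Measure.pi m :=
  Literature.Probability.LatticeModels.lintegral_four_functions_ae m (fun x => φ x * f x) (fun x => ψ x * f x) (fun x => φ x * ψ x * f x) f
    (hφm.mul hf) (hψm.mul hf) ((hφm.mul hψm).mul hf) hf (by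
      filter_upwards [hMTP] with p hp
      calc φ p.1 * f p.1 * (ψ p.2 * f p.2) = (φ p.1 * ψ p.2) * (f p.1 * f p.2) := by ring
        _ ≤ (φ (p.1 ⊔ p.2) * ψ (p.1 ⊔ p.2)) * (f (p.1 ⊓ p.2) * f (p.1 ⊔ p.2)) :=
            mul_le_mul' (mul_le_mul' (hφ le_sup_left) (hψ le_sup_right)) hp
        _ = φ (p.1 ⊔ p.2) * ψ (p.1 ⊔ p.2) * f (p.1 ⊔ p.2) * f (p.1 ⊓ p.2) := by ring)

/-- **Karlin–Rinott Thm. 2.3 verbatim (bounded real test functions, probability density) for a density that is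
MTP₂ on ALMOST EVERY PAIR**: `μ = ∏ᵢ μᵢ` σ-finite on `ℝ^ι`, `f ≥ 0` measurable with `∫ f dμ = 1` and
`f(x) f(y) ≤ f(x ∨ y) f(x ∧ y)` for `μ ⊗ μ`-a.e. `(x,y)`; then for bounded measurable coordinatewise non-decreasing
`φ, ψ`, `(∫ φ f dμ)(∫ ψ f dμ) ≤ ∫ φ ψ f dμ` — an a.e.-pair MTP₂ random vector is associated.  (The printed reduction
(2.8)–(2.13) exactly as in the tree's `KarlinRinott1980_thm_2_3_holds`, through `lintegral_four_functions_ae`.)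
[cite: BattyBollmann1980, Thm. 3.7 ((1.5) under a.e. (1.7))] [cite: KarlinRinott1980, Thm. 2.3] -/
theorem fkg_of_ae_mtp2 (μ : ι → Measure ℝ) [∀ i, SigmaFinite (μ i)] {f φ ψ : (ι → ℝ) → ℝ}
    (hfm : Measurable f) (hf0 : ∀ x, 0 ≤ f x) (hf1 : ∫ x, f x ∂Measure.pi μ = 1)
    (hf : ∀ᵐ p ∂(Measure.pi μ).prod (Measure.pi μ), f p.1 * f p.2 ≤ f (p.1 ⊔ p.2) * f (p.1 ⊓ p.2))
    (hφm : Measurable φ) (hψm : Measurable ψ) (hφ : Monotone φ) (hψ : Monotone ψ)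
    (hφb : ∃ C, ∀ x, |φ x| ≤ C) (hψb : ∃ C, ∀ x, |ψ x| ≤ C) :
    (∫ x, φ x * f x ∂Measure.pi μ) * (∫ x, ψ x * f x ∂Measure.pi μ) ≤
      ∫ x, φ x * ψ x * f x ∂Measure.pi μ := by
  obtain ⟨Cφ, hCφ⟩ := hφb
  obtain ⟨Cψ, hCψ⟩ := hψb
  set P := Measure.pi μ with hP
  have hfi : Integrable f P := Integrable.of_integral_ne_zero (by rw [hf1]; exact one_ne_zero)
  -- shifted nonnegative monotone functions
  set φ' : (ι → ℝ) → ℝ := fun x => φ x + Cφ with hφ'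
  set ψ' : (ι → ℝ) → ℝ := fun x => ψ x + Cψ with hψ'
  have hφ'0 : ∀ x, 0 ≤ φ' x := fun x => by
    have := (abs_le.1 (hCφ x)).1
    simp only [hφ']; linarith
  have hψ'0 : ∀ x, 0 ≤ ψ' x := fun x => by
    have := (abs_le.1 (hCψ x)).1
    simp only [hψ']; linarith
  have hφ'm : Monotone φ' := fun x y hxy => by simpa [hφ'] using hφ hxy
  have hψ'm : Monotone ψ' := fun x y hxy => by simpa [hψ'] using hψ hxy
  have hφ'meas : Measurable φ' := hφm.add_const _
  have hψ'meas : Measurable ψ' := hψm.add_const _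
  have hφ'b : ∀ x, ‖φ' x‖ ≤ 2 * Cφ := fun x => by
    have h1 := abs_le.1 (hCφ x)
    have h2 : 0 ≤ Cφ := (abs_nonneg _).trans (hCφ x)
    rw [Real.norm_eq_abs]
    show |φ x + Cφ| ≤ 2 * Cφ
    rw [abs_le]
    constructor <;> linarith [h1.1, h1.2]
  have hψ'b : ∀ x, ‖ψ' x‖ ≤ 2 * Cψ := fun x => by
    have h1 := abs_le.1 (hCψ x)
    have h2 : 0 ≤ Cψ := (abs_nonneg _).trans (hCψ x)
    rw [Real.norm_eq_abs]
    show |ψ x + Cψ| ≤ 2 * Cψ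
    rw [abs_le]
    constructor <;> linarith [h1.1, h1.2]
  -- integrability of the real integrands
  have iφf : Integrable (fun x => φ' x * f x) P :=
    hfi.bdd_mul hφ'meas.aestronglyMeasurable (Filter.Eventually.of_forall hφ'b)
  have iψf : Integrable (fun x => ψ' x * f x) P :=
    hfi.bdd_mul hψ'meas.aestronglyMeasurable (Filter.Eventually.of_forall hψ'b)
  have iφψf : Integrable (fun x => φ' x * (ψ' x * f x)) P :=
    iψf.bdd_mul hφ'meas.aestronglyMeasurable (Filter.Eventually.of_forall hφ'b)
  -- the four `[0,∞]`-valued functions, hypothesis on almost every pair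
  have AD := Literature.Probability.LatticeModels.lintegral_four_functions_ae μ (fun x => ENNReal.ofReal (φ' x * f x))
    (fun x => ENNReal.ofReal (ψ' x * f x)) (fun x => ENNReal.ofReal (φ' x * (ψ' x * f x)))
    (fun x => ENNReal.ofReal (f x)) (hφ'meas.mul hfm).ennreal_ofReal (hψ'meas.mul hfm).ennreal_ofReal
    (hφ'meas.mul (hψ'meas.mul hfm)).ennreal_ofReal hfm.ennreal_ofReal (by
      filter_upwards [hf] with p hp
      rw [← ENNReal.ofReal_mul (mul_nonneg (hφ'0 p.1) (hf0 p.1)),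
        ← ENNReal.ofReal_mul (mul_nonneg (hφ'0 _) (mul_nonneg (hψ'0 _) (hf0 _)))]
      apply ENNReal.ofReal_le_ofReal
      have k1 : φ' p.1 ≤ φ' (p.1 ⊔ p.2) := hφ'm le_sup_left
      have k2 : ψ' p.2 ≤ ψ' (p.1 ⊔ p.2) := hψ'm le_sup_right
      calc φ' p.1 * f p.1 * (ψ' p.2 * f p.2) = (φ' p.1 * ψ' p.2) * (f p.1 * f p.2) := by ring
        _ ≤ (φ' (p.1 ⊔ p.2) * ψ' (p.1 ⊔ p.2)) * (f (p.1 ⊔ p.2) * f (p.1 ⊓ p.2)) :=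
            mul_le_mul (mul_le_mul k1 k2 (hψ'0 _) (hφ'0 _)) hp (mul_nonneg (hf0 _) (hf0 _))
              (mul_nonneg (hφ'0 _) (hψ'0 _))
        _ = φ' (p.1 ⊔ p.2) * (ψ' (p.1 ⊔ p.2) * f (p.1 ⊔ p.2)) * f (p.1 ⊓ p.2) := by ring)
  -- back to real integrals
  rw [← ofReal_integral_eq_lintegral_ofReal iφf (Filter.Eventually.of_forall fun x =>
        mul_nonneg (hφ'0 x) (hf0 x)),
    ← ofReal_integral_eq_lintegral_ofReal iψf (Filter.Eventually.of_forall fun x =>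
        mul_nonneg (hψ'0 x) (hf0 x)),
    ← ofReal_integral_eq_lintegral_ofReal iφψf (Filter.Eventually.of_forall fun x =>
        mul_nonneg (hφ'0 x) (mul_nonneg (hψ'0 x) (hf0 x))),
    ← ofReal_integral_eq_lintegral_ofReal hfi (Filter.Eventually.of_forall hf0), hf1,
    ENNReal.ofReal_one, mul_one,
    ← ENNReal.ofReal_mul (integral_nonneg fun x => mul_nonneg (hφ'0 x) (hf0 x)),
    ENNReal.ofReal_le_ofReal_iff (integral_nonneg fun x =>
        mul_nonneg (hφ'0 x) (mul_nonneg (hψ'0 x) (hf0 x)))] at AD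
  -- AD : (∫ φ' f) * (∫ ψ' f) ≤ ∫ φ' ψ' f ; expand the shifts using `∫ f = 1`
  have iφf0 : Integrable (fun x => φ x * f x) P :=
    hfi.bdd_mul hφm.aestronglyMeasurable
      (Filter.Eventually.of_forall fun x => by rw [Real.norm_eq_abs]; exact hCφ x)
  have iψf0 : Integrable (fun x => ψ x * f x) P :=
    hfi.bdd_mul hψm.aestronglyMeasurable
      (Filter.Eventually.of_forall fun x => by rw [Real.norm_eq_abs]; exact hCψ x)
  have iφψf0 : Integrable (fun x => φ x * (ψ x * f x)) P :=
    iψf0.bdd_mul hφm.aestronglyMeasurable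
      (Filter.Eventually.of_forall fun x => by rw [Real.norm_eq_abs]; exact hCφ x)
  have e1 : ∫ x, φ' x * f x ∂P = (∫ x, φ x * f x ∂P) + Cφ := by
    have : (fun x => φ' x * f x) = fun x => φ x * f x + Cφ * f x := by
      funext x; simp only [hφ']; ring
    rw [this, integral_add iφf0 (hfi.const_mul _), integral_const_mul, hf1, mul_one]
  have e2 : ∫ x, ψ' x * f x ∂P = (∫ x, ψ x * f x ∂P) + Cψ := by
    have : (fun x => ψ' x * f x) = fun x => ψ x * f x + Cψ * f x := by
      funext x; simp only [hψ']; ring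
    rw [this, integral_add iψf0 (hfi.const_mul _), integral_const_mul, hf1, mul_one]
  have e3 : ∫ x, φ' x * (ψ' x * f x) ∂P =
      (∫ x, φ x * (ψ x * f x) ∂P) + Cψ * (∫ x, φ x * f x ∂P) + Cφ * (∫ x, ψ x * f x ∂P) + Cφ * Cψ := by
    have : (fun x => φ' x * (ψ' x * f x)) =
        fun x => φ x * (ψ x * f x) + Cψ * (φ x * f x) + Cφ * (ψ x * f x) + Cφ * Cψ * f x := by
      funext x; simp only [hφ', hψ']; ring
    have i12 : Integrable (fun x => φ x * (ψ x * f x) + Cψ * (φ x * f x)) P :=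
      iφψf0.add (iφf0.const_mul _)
    have i123 : Integrable (fun x => φ x * (ψ x * f x) + Cψ * (φ x * f x) + Cφ * (ψ x * f x)) P :=
      i12.add (iψf0.const_mul _)
    rw [this, integral_add i123 (hfi.const_mul _), integral_add i12 (iψf0.const_mul _),
      integral_add iφψf0 (iφf0.const_mul _), integral_const_mul, integral_const_mul,
      integral_const_mul, hf1, mul_one]
  rw [e1, e2, e3] at AD
  have goal_eq : ∫ x, φ x * ψ x * f x ∂P = ∫ x, φ x * (ψ x * f x) ∂P := by
    congr 1; funext x; ring
  rw [goal_eq]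
  nlinarith [AD]

end Summit.CriticalPhenomena.PercolationContinuityZ3.Theorems.SahiAEFourFunctions
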